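import Summits.HubbardSuperconductivity.HubbardSuperconductivity.Theorems.ThermalWedgeTwTipContinuationCrossRoute
import Summits.HubbardSuperconductivity.HubbardSuperconductivity.Theorems.ChiralWindowCwThesisBlockGroundEnergy
import Summits.HubbardSuperconductivity.HubbardSuperconductivity.Theorems.NoGoNogoThesis
import Literature.MathematicalPhysics.QuantumLattice.LiebFluxPhaseProofs
import Literature.MathematicalPhysics.QuantumLattice.HubbardWave0LiebProofs
import Literature.MathematicalPhysics.QuantumLattice.ApproximatingHamiltonianProofs
import Summits.HubbardSuperconductivity.HubbardSuperconductivity.Theorems.TwSeededEnsembleEquivalence.Negative.ObstructionTemplates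

/-!
# `TwTipContinuation` (stmt-HubbardSuperconductivity-1700) — line `SketchK5`
# (idea `sharp-sandwich-thermal-tip`): the sharp sandwich, the transfer theorem, and the normal
# form of the thermal penalty stub

Helpers for the crux `TwTipContinuation` of route `ThermalWedge` (line lead, re-seat a1), riding
`--supports stmt-HubbardSuperconductivity-1700`. Write `H_L = hubbardTorus 2 L 1 U`,
`P_L = Δ_dᴴ Δ_d` (`Δ_d = pairField dWaveFormFactor L`), `n_L = ⌊(1−δ)L²/2⌋`, `p` for Lieb's
`(n_L,n_L)` occupation sector (`#↑s = #↓s = n_L`, the coordinate form of `szSector (2n_L) 0`),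
`A_L = H_L|_p`, `B_L = (H_L + (κ/L⁴) P_L)|_p`, `F_β(K) = −β⁻¹ log Re Z_β(K)`, `E₀(K)` the ground
energy, `D_β(K) = E₀(K) − F_β(K) ≥ 0` the thermal depletion.

* `freeEnergy_le_groundEnergy` (`F_β ≤ E₀`), `freeEnergy_add_sub_le` (Peierls–Bogoliubov
  `F_β(A + W) − F_β(A) ≤ Re ω_{β,A}(W)`), `groundEnergy_sub_ge_of_sandwich` (spectral sandwich:
  `x ≤ F_β(B) − F_β(A)`, `D_β(A) ≤ y` ⇒ `x − y ≤ E₀(B) − E₀(A)`).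
* `sharpSandwich` — **the card's first lemma (FL)**: for Hermitian `H, Y`, `β > 0`, real `κ` and
  EVERY normalised ground vector `ψ` of `H`, `F_β(H+κY) − E₀(H) ≤ κ · Re⟨ψ, Yψ⟩`, i.e.
  `[F_β(H+κY) − F_β(H)] − D_β(H) ≤ κ · Re⟨ψ, Yψ⟩` (variational principle at `ψ`, then `F_β ≤ E₀`).
* `penaltyResponseWindow_of_thermal`, `twTipContinuation_of_thermal` — **the line's transfer,
  kernel-checked**: the two registered stubs of the skeleton `Lines/SketchK5.lean` as HYPOTHESES —
  (A) thermal pair-penalty response `a κ ≤ F_{CL}(B_L) − F_{CL}(A_L)` at one `δ` of the window for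
  all `U ∈ (0,U₁]`, (B) the order-blind depletion bound `D_{CL}(A_L) ≤ ε` — give the canonical
  penalty response window and hence `TwTipContinuation` (door
  `CrossRoute.twTipContinuation_of_penaltyResponseWindow`; `CwThesis.stub_blockGroundEnergy`).
* `thermalOrderWindow_of_thermalPenalty` — **normal form of stub (A)**: by Peierls–Bogoliubov, (A)
  alone gives THERMAL d-wave long-range order `a L⁴ ≤ Re ω_{CL, A_L}(P_L|_p)` of the PURE torus in
  the sector Gibbs state at `β_L = C L`, for all `U ∈ (0,U₁]` at one `δ ∈ [1/10,2/5]` — weak-coupling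
  d-wave superconductivity of the repulsive 2D Hubbard model (open in print; the size of the bet).

Sources: Ruelle, *Statistical Mechanics* (1969) §2.5; Bratteli–Robinson II §5.3.1; Tasaki (2020)
§2.1–2.2. No definition is introduced.
-/

noncomputable section

-- `dupNamespace`: the summit and the problem are both named `HubbardSuperconductivity` (layout D-0022)
set_option linter.dupNamespace false
-- the `(n,n)`-sector index type `{s : Finset (Orb Λ) // …}` needs a larger instance budget for
-- `DecidableEq` (structural instance through `Lex (Fin 2 → Fin L)`; tree precedent: CwThesisBlockGroundEnergy)
set_option synthInstance.maxSize 512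

namespace Summit.HubbardSuperconductivity.TwTipContinuation.SharpSandwich

open Matrix Filter Literature.MathematicalPhysics.QuantumLattice Literature.Probability.LatticeModels
open Summit.HubbardSuperconductivity.HubbardSuperconductivity.Theses.ThermalWedge
open Summit.HubbardSuperconductivity.HubbardSuperconductivity.Theorems.TwSeededEnsembleEquivalence.Negative
  (isHermitian_smul_seed)
open scoped ComplexOrder

/-! ### The sandwich on a finite Hermitian matrix -/

section Generic

variable {m : Type*} [Fintype m] [DecidableEq m]

/-- **`F_β(K) ≤ E₀(K)`**: the free energy `−β⁻¹ log Z_β(K)` of a Hermitian matrix on a nonempty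
index type never exceeds its ground energy (`e^{−βE₀} ≤ Z_β`, keep the ground-state term).
Ruelle, *Statistical Mechanics* (1969) §2.5. [folklore] -/
theorem freeEnergy_le_groundEnergy [Nonempty m] {K : Matrix m m ℂ} (hK : K.IsHermitian) {β : ℝ}
    (hβ : 0 < β) : -(1 / β) * Real.log (partitionFn β K).re ≤ K.groundEnergy := by
  have h2 := Real.log_le_log (Real.exp_pos _) (exp_neg_mul_groundEnergy_le_partitionFn hK β)
  rw [Real.log_exp] at h2
  have hβ' : 0 < 1 / β := by positivity
  have h3 : -(β * K.groundEnergy) * (1 / β) ≤ Real.log (partitionFn β K).re * (1 / β) :=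
    mul_le_mul_of_nonneg_right h2 hβ'.le
  have hs : -(β * K.groundEnergy) * (1 / β) = -K.groundEnergy := by field_simp
  rw [hs] at h3
  nlinarith

/-- **Peierls–Bogoliubov for free energies**: `F_β(A + W) − F_β(A) ≤ Re ω_{β,A}(W)` for Hermitian
`A, W` on a nonempty index type and `β > 0` (the tree's `log_partitionFn_sub_le_log_partitionFn_add`
divided by `β`). Ruelle (1969) §2.5. [folklore] -/
theorem freeEnergy_add_sub_le [Nonempty m] {A W : Matrix m m ℂ} (hA : A.IsHermitian)
    (hW : W.IsHermitian) {β : ℝ} (hβ : 0 < β) :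
    -(1 / β) * Real.log (partitionFn β (A + W)).re - -(1 / β) * Real.log (partitionFn β A).re ≤
      (gibbsState β A W).re := by
  have h := log_partitionFn_sub_le_log_partitionFn_add hA hW β
  have key : Real.log (partitionFn β A).re - Real.log (partitionFn β (A + W)).re ≤
      β * (gibbsState β A W).re := by linarith
  have e : -(1 / β) * Real.log (partitionFn β (A + W)).re - -(1 / β) * Real.log (partitionFn β A).re =
      (1 / β) * (Real.log (partitionFn β A).re - Real.log (partitionFn β (A + W)).re) := by ring
  rw [e]
  calc (1 / β) * (Real.log (partitionFn β A).re - Real.log (partitionFn β (A + W)).re)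
      ≤ (1 / β) * (β * (gibbsState β A W).re) := mul_le_mul_of_nonneg_left key (by positivity)
    _ = (gibbsState β A W).re := by field_simp

/-- **First lemma of the line (sharp sandwich), every-ground-state form.** For Hermitian `H`, `Y`
on a nonempty finite index type, `β > 0`, real `κ`, and every normalised ground vector `ψ` of `H`:
`F_β(H + κY) − E₀(H) ≤ κ · Re⟨ψ, Yψ⟩` (variational principle for `H + κY` at `ψ`, then
`F_β ≤ E₀`). Ruelle (1969) §2.5; Tasaki (2020) §2.1. [folklore] -/
theorem sharpSandwich [Nonempty m] (H Y : Matrix m m ℂ) (hH : H.IsHermitian) (hY : Y.IsHermitian)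
    {β : ℝ} (hβ : 0 < β) (κ : ℝ) (ψ : m → ℂ) (hψ : star ψ ⬝ᵥ ψ = 1)
    (hHψ : H *ᵥ ψ = ((H.groundEnergy : ℝ) : ℂ) • ψ) :
    -(1 / β) * Real.log (partitionFn β (H + (κ : ℂ) • Y)).re - H.groundEnergy ≤
      κ * (star ψ ⬝ᵥ Y *ᵥ ψ).re := by
  have hκY : ((κ : ℂ) • Y).IsHermitian := by
    rw [IsHermitian, conjTranspose_smul, hY.eq]; simp
  have hK : (H + (κ : ℂ) • Y).IsHermitian := hH.add hκY
  -- Step 1 (variational): E₀(H + κY) ≤ re⟨ψ,(H+κY)ψ⟩ = E₀(H) + κ re⟨ψ,Yψ⟩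
  have hray := groundEnergy_le_rayleigh_holds hK ψ hψ
  have hKψ : star ψ ⬝ᵥ (H + (κ : ℂ) • Y) *ᵥ ψ =
      (H.groundEnergy : ℂ) + (κ : ℂ) * (star ψ ⬝ᵥ Y *ᵥ ψ) := by
    rw [Matrix.add_mulVec, Matrix.smul_mulVec, dotProduct_add, dotProduct_smul, hHψ,
      dotProduct_smul, hψ]
    simp [smul_eq_mul]
  have h1 : (H + (κ : ℂ) • Y).groundEnergy ≤ H.groundEnergy + κ * (star ψ ⬝ᵥ Y *ᵥ ψ).re := by
    have := hray
    rw [hKψ] at this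
    simpa [Complex.add_re, Complex.mul_re] using this
  have h3 := freeEnergy_le_groundEnergy hK hβ
  linarith

/-- **The sharp sandwich, spectral form.** For Hermitian `B` (nonempty index type), `β > 0` and any
matrix `A`: a thermal penalty response `x ≤ F_β(B) − F_β(A)` and a depletion bound
`E₀(A) − F_β(A) ≤ y` give the ZERO-temperature response `x − y ≤ E₀(B) − E₀(A)`
(since `F_β(B) ≤ E₀(B)`). Ruelle (1969) §2.5. [folklore] -/
theorem groundEnergy_sub_ge_of_sandwich [Nonempty m] {A B : Matrix m m ℂ} (hB : B.IsHermitian)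
    {β x y : ℝ} (hβ : 0 < β)
    (hpen : x ≤ -(1 / β) * Real.log (partitionFn β B).re - -(1 / β) * Real.log (partitionFn β A).re)
    (hdep : A.groundEnergy - -(1 / β) * Real.log (partitionFn β A).re ≤ y) :
    x - y ≤ B.groundEnergy - A.groundEnergy := by
  have := freeEnergy_le_groundEnergy hB hβ
  linarith

end Generic

/-! ### Torus bookkeeping -/

/-- Lieb's `(n,n)` occupation sector of the torus of side `L` is nonempty for `n ≤ L²`
(`pairSet α α` for an `n`-subset `α` of the `L²` sites). Lieb, PRL 62 (1989) 1201. [folklore] -/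
theorem nonempty_sector (L : ℕ) {n : ℕ} (hn : n ≤ L ^ 2) :
    Nonempty {s : Finset (Orb (FermionTorus 2 L)) // (upPart s).card = n ∧ (downPart s).card = n} := by
  have hcard : Fintype.card (FermionTorus 2 L) = L ^ 2 :=
    Summit.HubbardSuperconductivity.NoGo.card_fermionTorus_two L
  obtain ⟨α, -, hα⟩ := Finset.exists_subset_card_eq (s := (Finset.univ : Finset (FermionTorus 2 L)))
    (n := n) (by rw [Finset.card_univ, hcard]; exact hn)
  exact ⟨⟨pairSet α α, by rw [upPart_pairSet, hα], by rw [downPart_pairSet, hα]⟩⟩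

/-- The penalised torus Hamiltonian `H_L(U) + (κ/L⁴) Δ_dᴴ Δ_d` is Hermitian (real multiple of the
Hermitian seed, `TwSeededEnsembleEquivalence.Negative.isHermitian_smul_seed`). [folklore] -/
theorem isHermitian_penalised (L : ℕ) [NeZero L] (U κ : ℝ) :
    (hubbardTorus 2 L 1 U + ((κ / (L : ℝ) ^ 4 : ℝ) : ℂ) •
        ((pairField dWaveFormFactor L)ᴴ * pairField dWaveFormFactor L)).IsHermitian :=
  (LiebThm1.hamiltonian_isHermitian _ 1 U).add (isHermitian_smul_seed L _)

/-- Compression commutes with scalars: `(c • X)|_p = c • X|_p`. [folklore] -/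
theorem toBlock_smul {ι : Type*} (X : Matrix ι ι ℂ) (c : ℂ) (p : ι → Prop) :
    (c • X).toBlock p p = c • X.toBlock p p := rfl

/-- Compression is additive: `(X + Y)|_p = X|_p + Y|_p`. [folklore] -/
theorem toBlock_add {ι : Type*} (X Y : Matrix ι ι ℂ) (p : ι → Prop) :
    (X + Y).toBlock p p = X.toBlock p p + Y.toBlock p p := rfl

/-! ### The transfer: (A) ∧ (B) ⇒ canonical penalty response ⇒ the crux -/

/-- **(A) ∧ (B) ⇒ the canonical pair-penalty response window** (the hypothesis of the landed door
`CrossRoute.twTipContinuation_of_penaltyResponseWindow`). Hypotheses = the registered stubs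
`stub_thermalPenalty` (A) and `stub_depletion` (B) of the skeleton `Lines/SketchK5.lean`, verbatim.
At the doping of (A), for `U < min U₁ U₂`, with `ε := aκ/2`, `C := max C₀ C₁`: the sandwich gives
`(a/2) κ ≤ E₀(B_L) − E₀(A_L)` and block ground energies are the sector energies
(`CwThesis.stub_blockGroundEnergy`). Ruelle (1969) §2.5; Tasaki (2020) §2.2. [folklore] -/
theorem penaltyResponseWindow_of_thermal
    (hA : ∃ U₁ : ℝ, 0 < U₁ ∧ ∃ δ ∈ Set.Icc (1 / 10 : ℝ) (2 / 5), ∀ U ∈ Set.Ioc (0 : ℝ) U₁,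
      ∃ κ : ℝ, 0 < κ ∧ ∃ a : ℝ, 0 < a ∧ ∃ C₀ : ℝ, ∀ C : ℝ, C₀ ≤ C →
        ∃ L₀ : ℕ, ∀ (L : ℕ) [NeZero L], L₀ ≤ L → Even L →
          a * κ ≤
            -(1 / (C * L)) * Real.log (partitionFn (C * L)
                ((hubbardTorus 2 L 1 U + ((κ / (L : ℝ) ^ 4 : ℝ) : ℂ) •
                    ((pairField dWaveFormFactor L)ᴴ * pairField dWaveFormFactor L)).toBlock
                  (fun s => (upPart s).card = ⌊(1 - δ) * (L : ℝ) ^ 2 / 2⌋₊ ∧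
                    (downPart s).card = ⌊(1 - δ) * (L : ℝ) ^ 2 / 2⌋₊)
                  (fun s => (upPart s).card = ⌊(1 - δ) * (L : ℝ) ^ 2 / 2⌋₊ ∧
                    (downPart s).card = ⌊(1 - δ) * (L : ℝ) ^ 2 / 2⌋₊))).re -
            -(1 / (C * L)) * Real.log (partitionFn (C * L)
                ((hubbardTorus 2 L 1 U).toBlock
                  (fun s => (upPart s).card = ⌊(1 - δ) * (L : ℝ) ^ 2 / 2⌋₊ ∧
                    (downPart s).card = ⌊(1 - δ) * (L : ℝ) ^ 2 / 2⌋₊)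
                  (fun s => (upPart s).card = ⌊(1 - δ) * (L : ℝ) ^ 2 / 2⌋₊ ∧
                    (downPart s).card = ⌊(1 - δ) * (L : ℝ) ^ 2 / 2⌋₊))).re)
    (hB : ∀ δ ∈ Set.Icc (1 / 10 : ℝ) (2 / 5), ∃ U₁ : ℝ, 0 < U₁ ∧ ∀ U ∈ Set.Ioc (0 : ℝ) U₁,
      ∀ ε : ℝ, 0 < ε → ∃ C₁ : ℝ, 0 < C₁ ∧ ∀ C : ℝ, C₁ ≤ C →
        ∃ L₀ : ℕ, ∀ (L : ℕ) [NeZero L], L₀ ≤ L → Even L →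
          ((hubbardTorus 2 L 1 U).toBlock
              (fun s => (upPart s).card = ⌊(1 - δ) * (L : ℝ) ^ 2 / 2⌋₊ ∧
                (downPart s).card = ⌊(1 - δ) * (L : ℝ) ^ 2 / 2⌋₊)
              (fun s => (upPart s).card = ⌊(1 - δ) * (L : ℝ) ^ 2 / 2⌋₊ ∧
                (downPart s).card = ⌊(1 - δ) * (L : ℝ) ^ 2 / 2⌋₊)).groundEnergy -
            -(1 / (C * L)) * Real.log (partitionFn (C * L)
                ((hubbardTorus 2 L 1 U).toBlock
                  (fun s => (upPart s).card = ⌊(1 - δ) * (L : ℝ) ^ 2 / 2⌋₊ ∧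
                    (downPart s).card = ⌊(1 - δ) * (L : ℝ) ^ 2 / 2⌋₊)
                  (fun s => (upPart s).card = ⌊(1 - δ) * (L : ℝ) ^ 2 / 2⌋₊ ∧
                    (downPart s).card = ⌊(1 - δ) * (L : ℝ) ^ 2 / 2⌋₊))).re ≤ ε) :
    ∃ δ ∈ Set.Icc (1 / 10 : ℝ) (2 / 5), ∃ U₀ : ℝ, 0 < U₀ ∧ ∀ U ∈ Set.Ioo (0 : ℝ) U₀,
      ∃ κ : ℝ, 0 < κ ∧ ∃ c : ℝ, 0 < c ∧ ∀ᶠ k : ℕ in Filter.atTop,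
        c * κ ≤
          Matrix.minEnergyOn (hubbardTorus 2 (2 * (k + 1)) 1 U +
              ((κ / ((2 * (k + 1) : ℕ) : ℝ) ^ 4 : ℝ) : ℂ) •
                ((pairField dWaveFormFactor (2 * (k + 1)))ᴴ * pairField dWaveFormFactor (2 * (k + 1))))
            (szSector (2 * ⌊(1 - δ) * ((2 * (k + 1) : ℕ) : ℝ) ^ 2 / 2⌋₊) 0) -
          Matrix.minEnergyOn (hubbardTorus 2 (2 * (k + 1)) 1 U)
            (szSector (2 * ⌊(1 - δ) * ((2 * (k + 1) : ℕ) : ℝ) ^ 2 / 2⌋₊) 0) := by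
  obtain ⟨U₁, hU₁, δ, hδ, hAU⟩ := hA
  obtain ⟨U₂, hU₂, hBU⟩ := hB δ hδ
  refine ⟨δ, hδ, min U₁ U₂, lt_min hU₁ hU₂, fun U hU => ?_⟩
  obtain ⟨κ, hκ, a, ha, C₀, hAC⟩ := hAU U ⟨hU.1, hU.2.le.trans (min_le_left _ _)⟩
  obtain ⟨C₁, hC₁, hBC⟩ :=
    hBU U ⟨hU.1, hU.2.le.trans (min_le_right _ _)⟩ (a * κ / 2) (by positivity)
  obtain ⟨L₀, hL₀⟩ := hAC (max C₀ C₁) (le_max_left _ _)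
  obtain ⟨L₁, hL₁⟩ := hBC (max C₀ C₁) (le_max_right _ _)
  refine ⟨κ, hκ, a / 2, by positivity, Filter.eventually_atTop.2 ⟨L₀ + L₁, fun k hk => ?_⟩⟩
  have hδ' : (-1 : ℝ) ≤ δ := by linarith [hδ.1]
  -- the side `L = 2(k+1)` and the half particle number `n = ⌊(1-δ)L²/2⌋ ≤ L²`
  set L : ℕ := 2 * (k + 1) with hLdef
  have hLeven : Even L := ⟨k + 1, by omega⟩
  have hn : ⌊(1 - δ) * (L : ℝ) ^ 2 / 2⌋₊ ≤ L ^ 2 :=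
    Summit.HubbardSuperconductivity.NoGo.floor_pairNumber_le δ hδ' L
  haveI := nonempty_sector L hn
  have hCpos : 0 < max C₀ C₁ := lt_of_lt_of_le hC₁ (le_max_right _ _)
  have hβ : 0 < max C₀ C₁ * (L : ℝ) := by
    have : (0 : ℝ) < (L : ℝ) := by positivity
    positivity
  have hApt := hL₀ L (by omega) hLeven
  have hBpt := hL₁ L (by omega) hLeven
  have hBh := isHermitian_penalised L U κ
  have hHh : (hubbardTorus 2 L 1 U).IsHermitian := LiebThm1.hamiltonian_isHermitian _ 1 U
  have hsand := groundEnergy_sub_ge_of_sandwich (by exact hBh.submatrix _) hβ hApt hBpt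
  rw [Summit.HubbardSuperconductivity.HubbardSuperconductivity.Theorems.CwThesis.stub_blockGroundEnergy
      L _ hBh hn,
    Summit.HubbardSuperconductivity.HubbardSuperconductivity.Theorems.CwThesis.stub_blockGroundEnergy
      L _ hHh hn] at hsand
  have e : a * κ - a * κ / 2 = a / 2 * κ := by ring
  rw [e] at hsand
  exact hsand

/-- **The line's transfer theorem, kernel-checked**: the registered stubs (A) `stub_thermalPenalty`
and (B) `stub_depletion` of `Lines/SketchK5.lean` (taken here as hypotheses, verbatim) imply the
crux `TwTipContinuation`, through `penaltyResponseWindow_of_thermal` and the landed door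
`CrossRoute.twTipContinuation_of_penaltyResponseWindow`. Ruelle (1969) §2.5. [folklore] -/
theorem twTipContinuation_of_thermal :
    (∃ U₁ : ℝ, 0 < U₁ ∧ ∃ δ ∈ Set.Icc (1 / 10 : ℝ) (2 / 5), ∀ U ∈ Set.Ioc (0 : ℝ) U₁,
      ∃ κ : ℝ, 0 < κ ∧ ∃ a : ℝ, 0 < a ∧ ∃ C₀ : ℝ, ∀ C : ℝ, C₀ ≤ C →
        ∃ L₀ : ℕ, ∀ (L : ℕ) [NeZero L], L₀ ≤ L → Even L →
          a * κ ≤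
            -(1 / (C * L)) * Real.log (partitionFn (C * L)
                ((hubbardTorus 2 L 1 U + ((κ / (L : ℝ) ^ 4 : ℝ) : ℂ) •
                    ((pairField dWaveFormFactor L)ᴴ * pairField dWaveFormFactor L)).toBlock
                  (fun s => (upPart s).card = ⌊(1 - δ) * (L : ℝ) ^ 2 / 2⌋₊ ∧
                    (downPart s).card = ⌊(1 - δ) * (L : ℝ) ^ 2 / 2⌋₊)
                  (fun s => (upPart s).card = ⌊(1 - δ) * (L : ℝ) ^ 2 / 2⌋₊ ∧
                    (downPart s).card = ⌊(1 - δ) * (L : ℝ) ^ 2 / 2⌋₊))).re -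
            -(1 / (C * L)) * Real.log (partitionFn (C * L)
                ((hubbardTorus 2 L 1 U).toBlock
                  (fun s => (upPart s).card = ⌊(1 - δ) * (L : ℝ) ^ 2 / 2⌋₊ ∧
                    (downPart s).card = ⌊(1 - δ) * (L : ℝ) ^ 2 / 2⌋₊)
                  (fun s => (upPart s).card = ⌊(1 - δ) * (L : ℝ) ^ 2 / 2⌋₊ ∧
                    (downPart s).card = ⌊(1 - δ) * (L : ℝ) ^ 2 / 2⌋₊))).re) →
    (∀ δ ∈ Set.Icc (1 / 10 : ℝ) (2 / 5), ∃ U₁ : ℝ, 0 < U₁ ∧ ∀ U ∈ Set.Ioc (0 : ℝ) U₁,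
      ∀ ε : ℝ, 0 < ε → ∃ C₁ : ℝ, 0 < C₁ ∧ ∀ C : ℝ, C₁ ≤ C →
        ∃ L₀ : ℕ, ∀ (L : ℕ) [NeZero L], L₀ ≤ L → Even L →
          ((hubbardTorus 2 L 1 U).toBlock
              (fun s => (upPart s).card = ⌊(1 - δ) * (L : ℝ) ^ 2 / 2⌋₊ ∧
                (downPart s).card = ⌊(1 - δ) * (L : ℝ) ^ 2 / 2⌋₊)
              (fun s => (upPart s).card = ⌊(1 - δ) * (L : ℝ) ^ 2 / 2⌋₊ ∧
                (downPart s).card = ⌊(1 - δ) * (L : ℝ) ^ 2 / 2⌋₊)).groundEnergy -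
            -(1 / (C * L)) * Real.log (partitionFn (C * L)
                ((hubbardTorus 2 L 1 U).toBlock
                  (fun s => (upPart s).card = ⌊(1 - δ) * (L : ℝ) ^ 2 / 2⌋₊ ∧
                    (downPart s).card = ⌊(1 - δ) * (L : ℝ) ^ 2 / 2⌋₊)
                  (fun s => (upPart s).card = ⌊(1 - δ) * (L : ℝ) ^ 2 / 2⌋₊ ∧
                    (downPart s).card = ⌊(1 - δ) * (L : ℝ) ^ 2 / 2⌋₊))).re ≤ ε) →
    TwTipContinuation := fun hA hB =>
  Summit.HubbardSuperconductivity.TwTipContinuation.CrossRoute.twTipContinuation_of_penaltyResponseWindow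
    (penaltyResponseWindow_of_thermal hA hB)

/-! ### Normal form of stub (A): thermal d-wave order of the pure torus at `β_L = C·L` -/

/-- **What stub (A) costs.** By Peierls–Bogoliubov (`F_β(A + W) − F_β(A) ≤ Re ω_{β,A}(W)` with
`W = (κ/L⁴) P_L|_p`), the thermal penalty response (A) ALONE implies THERMAL d-wave long-range order
of the PURE torus in the `(N_L,S^z=0)`-sector Gibbs state at the polynomial schedule `β_L = C L`:
`a L⁴ ≤ Re ω_{CL, H_L|_p}(P_L|_p)` for every `U ∈ (0,U₁]` at one `δ ∈ [1/10,2/5]`, all `C ≥ C₀'`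
(`C₀' > 0`), eventually in even `L` — weak-coupling d-wave superconducting order of the repulsive
2D Hubbard torus (open in print). Ruelle (1969) §2.5. [folklore] -/
theorem thermalOrderWindow_of_thermalPenalty
    (hA : ∃ U₁ : ℝ, 0 < U₁ ∧ ∃ δ ∈ Set.Icc (1 / 10 : ℝ) (2 / 5), ∀ U ∈ Set.Ioc (0 : ℝ) U₁,
      ∃ κ : ℝ, 0 < κ ∧ ∃ a : ℝ, 0 < a ∧ ∃ C₀ : ℝ, ∀ C : ℝ, C₀ ≤ C →
        ∃ L₀ : ℕ, ∀ (L : ℕ) [NeZero L], L₀ ≤ L → Even L →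
          a * κ ≤
            -(1 / (C * L)) * Real.log (partitionFn (C * L)
                ((hubbardTorus 2 L 1 U + ((κ / (L : ℝ) ^ 4 : ℝ) : ℂ) •
                    ((pairField dWaveFormFactor L)ᴴ * pairField dWaveFormFactor L)).toBlock
                  (fun s => (upPart s).card = ⌊(1 - δ) * (L : ℝ) ^ 2 / 2⌋₊ ∧
                    (downPart s).card = ⌊(1 - δ) * (L : ℝ) ^ 2 / 2⌋₊)
                  (fun s => (upPart s).card = ⌊(1 - δ) * (L : ℝ) ^ 2 / 2⌋₊ ∧
                    (downPart s).card = ⌊(1 - δ) * (L : ℝ) ^ 2 / 2⌋₊))).re -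
            -(1 / (C * L)) * Real.log (partitionFn (C * L)
                ((hubbardTorus 2 L 1 U).toBlock
                  (fun s => (upPart s).card = ⌊(1 - δ) * (L : ℝ) ^ 2 / 2⌋₊ ∧
                    (downPart s).card = ⌊(1 - δ) * (L : ℝ) ^ 2 / 2⌋₊)
                  (fun s => (upPart s).card = ⌊(1 - δ) * (L : ℝ) ^ 2 / 2⌋₊ ∧
                    (downPart s).card = ⌊(1 - δ) * (L : ℝ) ^ 2 / 2⌋₊))).re) :
    ∃ U₁ : ℝ, 0 < U₁ ∧ ∃ δ ∈ Set.Icc (1 / 10 : ℝ) (2 / 5), ∀ U ∈ Set.Ioc (0 : ℝ) U₁,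
      ∃ a : ℝ, 0 < a ∧ ∃ C₀ : ℝ, 0 < C₀ ∧ ∀ C : ℝ, C₀ ≤ C →
        ∃ L₀ : ℕ, ∀ (L : ℕ) [NeZero L], L₀ ≤ L → Even L →
          a * (L : ℝ) ^ 4 ≤
            (gibbsState (C * L)
              ((hubbardTorus 2 L 1 U).toBlock
                (fun s => (upPart s).card = ⌊(1 - δ) * (L : ℝ) ^ 2 / 2⌋₊ ∧
                  (downPart s).card = ⌊(1 - δ) * (L : ℝ) ^ 2 / 2⌋₊)
                (fun s => (upPart s).card = ⌊(1 - δ) * (L : ℝ) ^ 2 / 2⌋₊ ∧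
                  (downPart s).card = ⌊(1 - δ) * (L : ℝ) ^ 2 / 2⌋₊))
              (((pairField dWaveFormFactor L)ᴴ * pairField dWaveFormFactor L).toBlock
                (fun s => (upPart s).card = ⌊(1 - δ) * (L : ℝ) ^ 2 / 2⌋₊ ∧
                  (downPart s).card = ⌊(1 - δ) * (L : ℝ) ^ 2 / 2⌋₊)
                (fun s => (upPart s).card = ⌊(1 - δ) * (L : ℝ) ^ 2 / 2⌋₊ ∧
                  (downPart s).card = ⌊(1 - δ) * (L : ℝ) ^ 2 / 2⌋₊))).re := by
  obtain ⟨U₁, hU₁, δ, hδ, hAU⟩ := hA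
  refine ⟨U₁, hU₁, δ, hδ, fun U hU => ?_⟩
  obtain ⟨κ, hκ, a, ha, C₀, hAC⟩ := hAU U hU
  refine ⟨a, ha, max C₀ 1, lt_of_lt_of_le one_pos (le_max_right _ _), fun C hC => ?_⟩
  obtain ⟨L₀, hL₀⟩ := hAC C ((le_max_left _ _).trans hC)
  refine ⟨L₀, fun L _ hL hE => ?_⟩
  have hδ' : (-1 : ℝ) ≤ δ := by linarith [hδ.1]
  have hn : ⌊(1 - δ) * (L : ℝ) ^ 2 / 2⌋₊ ≤ L ^ 2 :=
    Summit.HubbardSuperconductivity.NoGo.floor_pairNumber_le δ hδ' L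
  haveI := nonempty_sector L hn
  have hLpos : (0 : ℝ) < (L : ℝ) := Nat.cast_pos.2 (Nat.pos_of_ne_zero (NeZero.ne L))
  have hCpos : 0 < C := lt_of_lt_of_le one_pos ((le_max_right _ _).trans hC)
  have hβ : 0 < C * (L : ℝ) := mul_pos hCpos hLpos
  have hApt := hL₀ L hL hE
  have hHh : (hubbardTorus 2 L 1 U).IsHermitian := LiebThm1.hamiltonian_isHermitian _ 1 U
  have hWh := isHermitian_smul_seed L (κ / (L : ℝ) ^ 4)
  -- Peierls–Bogoliubov on the block: `F(A + W|_p) − F(A) ≤ Re ω_A(W|_p)`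
  rw [toBlock_add] at hApt
  have hle := hApt.trans
    (freeEnergy_add_sub_le (by exact hHh.submatrix _) (by exact hWh.submatrix _) hβ)
  have hsm : (gibbsState (C * L)
      ((hubbardTorus 2 L 1 U).toBlock
        (fun s => (upPart s).card = ⌊(1 - δ) * (L : ℝ) ^ 2 / 2⌋₊ ∧
          (downPart s).card = ⌊(1 - δ) * (L : ℝ) ^ 2 / 2⌋₊)
        (fun s => (upPart s).card = ⌊(1 - δ) * (L : ℝ) ^ 2 / 2⌋₊ ∧
          (downPart s).card = ⌊(1 - δ) * (L : ℝ) ^ 2 / 2⌋₊))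
      ((((κ / (L : ℝ) ^ 4 : ℝ) : ℂ) •
          ((pairField dWaveFormFactor L)ᴴ * pairField dWaveFormFactor L)).toBlock
        (fun s => (upPart s).card = ⌊(1 - δ) * (L : ℝ) ^ 2 / 2⌋₊ ∧
          (downPart s).card = ⌊(1 - δ) * (L : ℝ) ^ 2 / 2⌋₊)
        (fun s => (upPart s).card = ⌊(1 - δ) * (L : ℝ) ^ 2 / 2⌋₊ ∧
          (downPart s).card = ⌊(1 - δ) * (L : ℝ) ^ 2 / 2⌋₊))).re =
      κ / (L : ℝ) ^ 4 * (gibbsState (C * L)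
        ((hubbardTorus 2 L 1 U).toBlock
          (fun s => (upPart s).card = ⌊(1 - δ) * (L : ℝ) ^ 2 / 2⌋₊ ∧
            (downPart s).card = ⌊(1 - δ) * (L : ℝ) ^ 2 / 2⌋₊)
          (fun s => (upPart s).card = ⌊(1 - δ) * (L : ℝ) ^ 2 / 2⌋₊ ∧
            (downPart s).card = ⌊(1 - δ) * (L : ℝ) ^ 2 / 2⌋₊))
        (((pairField dWaveFormFactor L)ᴴ * pairField dWaveFormFactor L).toBlock
          (fun s => (upPart s).card = ⌊(1 - δ) * (L : ℝ) ^ 2 / 2⌋₊ ∧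
            (downPart s).card = ⌊(1 - δ) * (L : ℝ) ^ 2 / 2⌋₊)
          (fun s => (upPart s).card = ⌊(1 - δ) * (L : ℝ) ^ 2 / 2⌋₊ ∧
            (downPart s).card = ⌊(1 - δ) * (L : ℝ) ^ 2 / 2⌋₊))).re := by
    rw [toBlock_smul, map_smul, smul_eq_mul, Complex.re_ofReal_mul]
  rw [hsm] at hle
  set G : ℝ := (gibbsState (C * L)
        ((hubbardTorus 2 L 1 U).toBlock
          (fun s => (upPart s).card = ⌊(1 - δ) * (L : ℝ) ^ 2 / 2⌋₊ ∧
            (downPart s).card = ⌊(1 - δ) * (L : ℝ) ^ 2 / 2⌋₊)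
          (fun s => (upPart s).card = ⌊(1 - δ) * (L : ℝ) ^ 2 / 2⌋₊ ∧
            (downPart s).card = ⌊(1 - δ) * (L : ℝ) ^ 2 / 2⌋₊))
        (((pairField dWaveFormFactor L)ᴴ * pairField dWaveFormFactor L).toBlock
          (fun s => (upPart s).card = ⌊(1 - δ) * (L : ℝ) ^ 2 / 2⌋₊ ∧
            (downPart s).card = ⌊(1 - δ) * (L : ℝ) ^ 2 / 2⌋₊)
          (fun s => (upPart s).card = ⌊(1 - δ) * (L : ℝ) ^ 2 / 2⌋₊ ∧
            (downPart s).card = ⌊(1 - δ) * (L : ℝ) ^ 2 / 2⌋₊))).re with hG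
  have hL4 : (0 : ℝ) < (L : ℝ) ^ 4 := by positivity
  have h2 : a * κ * (L : ℝ) ^ 4 ≤ κ * G := by
    have := mul_le_mul_of_nonneg_right hle hL4.le
    calc a * κ * (L : ℝ) ^ 4 ≤ κ / (L : ℝ) ^ 4 * G * (L : ℝ) ^ 4 := this
      _ = κ * G := by field_simp
  have h3 : κ * (a * (L : ℝ) ^ 4) ≤ κ * G := by
    calc κ * (a * (L : ℝ) ^ 4) = a * κ * (L : ℝ) ^ 4 := by ring
      _ ≤ κ * G := h2
  exact le_of_mul_le_mul_left h3 hκ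

end Summit.HubbardSuperconductivity.TwTipContinuation.SharpSandwich

end
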